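import Mathlib.NumberTheory.Padics.MahlerBasis
import Mathlib.RingTheory.PowerSeries.Derivative
import Mathlib.RingTheory.PowerSeries.Binomial
import Mathlib.Analysis.Normed.Ring.Ultra
import Mathlib.Analysis.Normed.Ring.InfiniteSum
import HarnessLib

/-!
# Evaluating a bounded `p`-adic power series and its derivative at a point of the open unit disc of `ℚ_p`:
# product rule, scalars, and the binomial series `(1+T)^s` (PROOFS ONLY: no `def`, no named fact)

Topic `Literature/NumberTheory/EllipticCurves`; namespace `Literature.NumberTheory.EllipticCurves.PadicEval`.
Elementary `p`-adic analysis used when a `p`-adic `L`-function `L_p(T) = ∑ c_k T^k ∈ ℚ_p⟦T⟧` with BOUNDED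
coefficients (an element of `Λ ⊗ ℚ_p`, Mazur–Tate–Teitelbaum §I.12) is read at a character point `T = a`,
`‖a‖ < 1` (at `p = 2`: the conductor-`8` character sits at `a = χ₈(γ) − 1 = −2`), together with its DERIVATIVE
functional `∑_k k c_k a^{k−1}` (the leading term at a simple zero). Everything is a theorem; the only inputs are
Mathlib's Cauchy product of absolutely convergent series in a complete normed ring
(`tsum_mul_tsum_eq_tsum_sum_antidiagonal_of_summable_norm`), the ultrametric inequality for sums in `ℚ_p`, the
Leibniz rule for formal power series (`PowerSeries.derivativeFun_mul`) and the binomial series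
`binomialSeries ℚ_p s = ∑ (s choose k) T^k`, `s ∈ ℤ_p` (`PowerSeries.binomialSeries`, Mathlib's binomial ring `ℤ_p`).

* `summable_of_norm_le`, `summable_norm_of_norm_le` — `∑ c_k a^k` converges (absolutely) for bounded `(c_k)`, `‖a‖ < 1`;
  `norm_coeff_mul_le` (coefficients of a product of bounded series are bounded, ultrametric),
  `norm_coeff_derivativeFun_le` (so are those of the formal derivative, `‖n+1‖ ≤ 1`), `norm_coeff_C_mul_le`.
* `tsum_coeff_mul` — evaluation is MULTIPLICATIVE: `ev_a(F·G) = ev_a(F)·ev_a(G)`.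
* `hasSum_derivativeFun_iff`, `tsum_deriv_eq_tsum_derivativeFun` — `∑_k k c_k a^{k−1} = ev_a(F′)`;
  `tsum_deriv_mul` — PRODUCT RULE `D_a(F·G) = D_a(F)·ev_a(G) + ev_a(F)·D_a(G)`; `tsum_deriv_mul_of_eval_eq_zero` — at a
  zero of `G`, `D_a(F·G) = ev_a(F)·D_a(G)`; `tsum_eval_C_mul`, `tsum_deriv_C_mul` — scalars pull out.
* `norm_coeff_binomialSeries_le_one`, `norm_tsum_eval_le_one`, `tsum_eval_binomialSeries_mul_neg`,
  `norm_tsum_eval_binomialSeries` — **`ev_a((1+T)^s)` is a `p`-adic UNIT of norm `1`** for every `s ∈ ℤ_p`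
  (`(1+T)^s·(1+T)^{−s} = 1`, both values of norm `≤ 1`).

References: B. Mazur, J. Tate, J. Teitelbaum, Invent. Math. 84 (1986) §I.12–I.13 [MazurTateTeitelbaum1986Invent];
L. C. Washington, *Introduction to Cyclotomic Fields*, GTM 83 (1997) §7.1–7.2 [Washington1997]; R. Greenberg,
V. Vatsal, Invent. Math. 142 (2000) §1 (p. 9: `γ_ℓ = (1+T)^{f_ℓ}`) [GreenbergVatsal2000].
-/

noncomputable section

open Filter Topology PowerSeries

namespace Literature.NumberTheory.EllipticCurves.PadicEval

variable {p : ℕ} [Fact p.Prime]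

/-! ### Bounded coefficients: summability and stability -/

/-- A series with bounded coefficients converges absolutely at a point of the open unit disc of `ℚ_p`.
[cite: Washington1997, §7.1–7.2] -/
theorem summable_norm_of_norm_le {F : PowerSeries ℚ_[p]} {C : ℝ} (hF : ∀ k, ‖coeff k F‖ ≤ C)
    {a : ℚ_[p]} (ha : ‖a‖ < 1) : Summable (fun k : ℕ ↦ ‖coeff k F * a ^ k‖) := by
  have hC0 : 0 ≤ C := (norm_nonneg _).trans (hF 0)
  refine Summable.of_nonneg_of_le (fun k ↦ norm_nonneg _) (fun k ↦ ?_)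
    ((summable_geometric_of_lt_one (norm_nonneg _) ha).mul_left C)
  rw [norm_mul, norm_pow]
  exact mul_le_mul_of_nonneg_right (hF k) (pow_nonneg (norm_nonneg _) _)

/-- A series with bounded coefficients converges at a point of the open unit disc of `ℚ_p`.
[cite: Washington1997, §7.1–7.2] -/
theorem summable_of_norm_le {F : PowerSeries ℚ_[p]} {C : ℝ} (hF : ∀ k, ‖coeff k F‖ ≤ C)
    {a : ℚ_[p]} (ha : ‖a‖ < 1) : Summable (fun k : ℕ ↦ coeff k F * a ^ k) :=
  (summable_norm_of_norm_le hF ha).of_norm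

/-- **Coefficients of a product of bounded series are bounded** (ultrametric inequality on `∑_{i+j=k} F_i G_j`).
[cite: Washington1997, §7.1] -/
theorem norm_coeff_mul_le {F G : PowerSeries ℚ_[p]} {C₁ C₂ : ℝ} (hF : ∀ i, ‖coeff i F‖ ≤ C₁)
    (hG : ∀ j, ‖coeff j G‖ ≤ C₂) (k : ℕ) : ‖coeff k (F * G)‖ ≤ C₁ * C₂ := by
  have hC₁ : 0 ≤ C₁ := (norm_nonneg _).trans (hF 0)
  have hC₂ : 0 ≤ C₂ := (norm_nonneg _).trans (hG 0)
  rw [coeff_mul]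
  refine IsUltrametricDist.norm_sum_le_of_forall_le_of_nonneg (mul_nonneg hC₁ hC₂) fun ij _ ↦ ?_
  rw [norm_mul]
  exact mul_le_mul (hF _) (hG _) (norm_nonneg _) hC₁

/-- Coefficients of `C(c)·F` are bounded by `‖c‖·C`. [cite: Washington1997, §7.1] -/
theorem norm_coeff_C_mul_le {F : PowerSeries ℚ_[p]} {C : ℝ} (hF : ∀ k, ‖coeff k F‖ ≤ C) (c : ℚ_[p])
    (k : ℕ) : ‖coeff k (PowerSeries.C c * F)‖ ≤ ‖c‖ * C := by
  rw [coeff_C_mul, norm_mul]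
  exact mul_le_mul_of_nonneg_left (hF k) (norm_nonneg _)

/-- **The formal derivative of a bounded series is bounded** (`‖n + 1‖_p ≤ 1`). [cite: MazurTateTeitelbaum1986Invent, §I.12] -/
theorem norm_coeff_derivativeFun_le {F : PowerSeries ℚ_[p]} {C : ℝ} (hF : ∀ k, ‖coeff k F‖ ≤ C) (n : ℕ) :
    ‖coeff n F.derivativeFun‖ ≤ C := by
  have hC : 0 ≤ C := (norm_nonneg _).trans (hF 0)
  rw [coeff_derivativeFun, norm_mul, show ((n : ℚ_[p]) + 1) = ((n + 1 : ℕ) : ℚ_[p]) by push_cast; ring]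
  calc ‖coeff (n + 1) F‖ * ‖((n + 1 : ℕ) : ℚ_[p])‖ ≤ C * 1 :=
        mul_le_mul (hF _) (IsUltrametricDist.norm_natCast_le_one ℚ_[p] _) (norm_nonneg _) hC
    _ = C := mul_one C

/-! ### Evaluation is multiplicative; scalars -/

/-- **Evaluation on the open unit disc is multiplicative**: `∑_k [T^k](F G) a^k = (∑_k F_k a^k)(∑_k G_k a^k)` for
bounded `F`, `G` and `‖a‖ < 1` — the Cauchy product of two absolutely convergent series in the complete field `ℚ_p`.
[cite: Washington1997, §7.2] -/
theorem tsum_coeff_mul {F G : PowerSeries ℚ_[p]} {C₁ C₂ : ℝ} (hF : ∀ k, ‖coeff k F‖ ≤ C₁)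
    (hG : ∀ k, ‖coeff k G‖ ≤ C₂) {a : ℚ_[p]} (ha : ‖a‖ < 1) :
    ∑' k, coeff k (F * G) * a ^ k = (∑' k, coeff k F * a ^ k) * ∑' k, coeff k G * a ^ k := by
  rw [tsum_mul_tsum_eq_tsum_sum_antidiagonal_of_summable_norm (summable_norm_of_norm_le hF ha)
    (summable_norm_of_norm_le hG ha)]
  refine tsum_congr fun n ↦ ?_
  rw [coeff_mul, Finset.sum_mul]
  refine Finset.sum_congr rfl fun kl hkl ↦ ?_
  rw [Finset.HasAntidiagonal.mem_antidiagonal] at hkl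
  rw [← hkl, pow_add]
  ring

/-- Scalars pull out of the evaluation: `ev_a(C(c)·F) = c · ev_a(F)` (no convergence needed). [cite: Washington1997, §7.2] -/
theorem tsum_eval_C_mul (c : ℚ_[p]) (F : PowerSeries ℚ_[p]) (a : ℚ_[p]) :
    ∑' k, coeff k (PowerSeries.C c * F) * a ^ k = c * ∑' k, coeff k F * a ^ k := by
  rw [← tsum_mul_left]
  exact tsum_congr fun k ↦ by rw [coeff_C_mul, mul_assoc]

/-- Scalars pull out of the evaluation, `HasSum` form. [cite: Washington1997, §7.2] -/
theorem hasSum_eval_C_mul_iff {c : ℚ_[p]} (hc : c ≠ 0) (F : PowerSeries ℚ_[p]) (a s : ℚ_[p]) :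
    HasSum (fun k ↦ coeff k (PowerSeries.C c * F) * a ^ k) (c * s) ↔
      HasSum (fun k ↦ coeff k F * a ^ k) s := by
  have hfun : (fun k ↦ coeff k (PowerSeries.C c * F) * a ^ k) = fun k ↦ c * (coeff k F * a ^ k) := by
    funext k; rw [coeff_C_mul, mul_assoc]
  rw [hfun]
  exact hasSum_mul_left_iff hc

/-! ### The derivative functional `D_a(F) = ∑_k k F_k a^{k−1}` -/

/-- **Re-indexing the derivative**: `∑_n [Tⁿ]F′ · aⁿ` and `∑_k k·F_k·a^{k−1}` have the same sums (`[Tⁿ]F′ = (n+1)F_{n+1}`;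
the `k = 0` term vanishes). [cite: MazurTateTeitelbaum1986Invent, §I.13] -/
theorem hasSum_derivativeFun_iff {F : PowerSeries ℚ_[p]} {a s : ℚ_[p]} :
    HasSum (fun n : ℕ ↦ coeff n F.derivativeFun * a ^ n) s ↔
      HasSum (fun k : ℕ ↦ coeff k F * (k : ℚ_[p]) * a ^ (k - 1)) s := by
  have h := hasSum_nat_add_iff (f := fun k : ℕ ↦ coeff k F * (k : ℚ_[p]) * a ^ (k - 1)) 1 (g := s)
  simp only [Finset.sum_range_one, Nat.cast_zero, mul_zero, zero_mul, add_zero] at h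
  rw [← h]
  have hfun : (fun n : ℕ ↦ coeff n F.derivativeFun * a ^ n) =
      fun n : ℕ ↦ coeff (n + 1) F * (((n + 1 : ℕ)) : ℚ_[p]) * a ^ (n + 1 - 1) := by
    funext n
    rw [coeff_derivativeFun, Nat.cast_succ, Nat.add_sub_cancel]
  rw [hfun]

/-- The derivative functional of a bounded series converges at `‖a‖ < 1`. [cite: MazurTateTeitelbaum1986Invent, §I.13] -/
theorem summable_deriv_of_norm_le {F : PowerSeries ℚ_[p]} {C : ℝ} (hF : ∀ k, ‖coeff k F‖ ≤ C)
    {a : ℚ_[p]} (ha : ‖a‖ < 1) : Summable (fun k : ℕ ↦ coeff k F * (k : ℚ_[p]) * a ^ (k - 1)) :=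
  (hasSum_derivativeFun_iff.mp (summable_of_norm_le (norm_coeff_derivativeFun_le hF) ha).hasSum).summable

/-- `D_a(F) = ev_a(F′)` for bounded `F`, `‖a‖ < 1`. [cite: MazurTateTeitelbaum1986Invent, §I.13] -/
theorem tsum_deriv_eq_tsum_derivativeFun {F : PowerSeries ℚ_[p]} {C : ℝ} (hF : ∀ k, ‖coeff k F‖ ≤ C)
    {a : ℚ_[p]} (ha : ‖a‖ < 1) :
    ∑' k, coeff k F * (k : ℚ_[p]) * a ^ (k - 1) = ∑' n, coeff n F.derivativeFun * a ^ n :=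
  ((hasSum_derivativeFun_iff.mp (summable_of_norm_le (norm_coeff_derivativeFun_le hF) ha).hasSum).tsum_eq)

/-- Scalars pull out of the derivative functional: `D_a(C(c)·F) = c · D_a(F)`. [cite: MazurTateTeitelbaum1986Invent, §I.13] -/
theorem tsum_deriv_C_mul (c : ℚ_[p]) (F : PowerSeries ℚ_[p]) (a : ℚ_[p]) :
    ∑' k, coeff k (PowerSeries.C c * F) * (k : ℚ_[p]) * a ^ (k - 1) =
      c * ∑' k, coeff k F * (k : ℚ_[p]) * a ^ (k - 1) := by
  rw [← tsum_mul_left]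
  exact tsum_congr fun k ↦ by rw [coeff_C_mul]; ring

/-- **Product rule for the derivative functional**: for bounded `F`, `G` and `‖a‖ < 1`,
`D_a(F·G) = D_a(F)·ev_a(G) + ev_a(F)·D_a(G)` (Leibniz for formal series + multiplicativity of evaluation).
[cite: MazurTateTeitelbaum1986Invent, §I.13] [cite: Washington1997, §7.2] -/
theorem tsum_deriv_mul {F G : PowerSeries ℚ_[p]} {C₁ C₂ : ℝ} (hF : ∀ k, ‖coeff k F‖ ≤ C₁)
    (hG : ∀ k, ‖coeff k G‖ ≤ C₂) {a : ℚ_[p]} (ha : ‖a‖ < 1) :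
    ∑' k, coeff k (F * G) * (k : ℚ_[p]) * a ^ (k - 1) =
      (∑' k, coeff k F * (k : ℚ_[p]) * a ^ (k - 1)) * (∑' k, coeff k G * a ^ k) +
        (∑' k, coeff k F * a ^ k) * ∑' k, coeff k G * (k : ℚ_[p]) * a ^ (k - 1) := by
  have hFG : ∀ k, ‖coeff k (F * G)‖ ≤ C₁ * C₂ := norm_coeff_mul_le hF hG
  rw [tsum_deriv_eq_tsum_derivativeFun hFG ha, tsum_deriv_eq_tsum_derivativeFun hF ha,
    tsum_deriv_eq_tsum_derivativeFun hG ha, derivativeFun_mul, smul_eq_mul, smul_eq_mul]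
  have h1 : Summable (fun n : ℕ ↦ coeff n (F * G.derivativeFun) * a ^ n) :=
    summable_of_norm_le (norm_coeff_mul_le hF (norm_coeff_derivativeFun_le hG)) ha
  have h2 : Summable (fun n : ℕ ↦ coeff n (G * F.derivativeFun) * a ^ n) :=
    summable_of_norm_le (norm_coeff_mul_le hG (norm_coeff_derivativeFun_le hF)) ha
  have hsplit : (fun n : ℕ ↦ coeff n (F * G.derivativeFun + G * F.derivativeFun) * a ^ n) =
      fun n ↦ coeff n (F * G.derivativeFun) * a ^ n + coeff n (G * F.derivativeFun) * a ^ n := by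
    funext n; rw [map_add, add_mul]
  rw [hsplit, h1.tsum_add h2, tsum_coeff_mul hF (norm_coeff_derivativeFun_le hG) ha,
    tsum_coeff_mul hG (norm_coeff_derivativeFun_le hF) ha]
  ring

/-- **At a zero of `G`**: `ev_a(G) = 0 ⇒ D_a(F·G) = ev_a(F)·D_a(G)` (the leading term of a product at a simple zero).
[cite: MazurTateTeitelbaum1986Invent, §I.13] -/
theorem tsum_deriv_mul_of_eval_eq_zero {F G : PowerSeries ℚ_[p]} {C₁ C₂ : ℝ} (hF : ∀ k, ‖coeff k F‖ ≤ C₁)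
    (hG : ∀ k, ‖coeff k G‖ ≤ C₂) {a : ℚ_[p]} (ha : ‖a‖ < 1) (h0 : ∑' k, coeff k G * a ^ k = 0) :
    ∑' k, coeff k (F * G) * (k : ℚ_[p]) * a ^ (k - 1) =
      (∑' k, coeff k F * a ^ k) * ∑' k, coeff k G * (k : ℚ_[p]) * a ^ (k - 1) := by
  rw [tsum_deriv_mul hF hG ha, h0, mul_zero, zero_add]

/-! ### The binomial series `(1+T)^s`, `s ∈ ℤ_p`, evaluates to a unit -/

/-- The coefficients `(s choose k) ∈ ℤ_p` of `(1+T)^s = binomialSeries ℚ_p s` have norm `≤ 1`.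
[cite: GreenbergVatsal2000, §1 (p. 9)] -/
theorem norm_coeff_binomialSeries_le_one (s : ℤ_[p]) (k : ℕ) : ‖coeff k (binomialSeries ℚ_[p] s)‖ ≤ 1 := by
  rw [binomialSeries_coeff, Algebra.smul_def, mul_one, PadicInt.algebraMap_apply]
  exact PadicInt.norm_le_one _

/-- Evaluation of a series with coefficients of norm `≤ 1` at `‖a‖ < 1` has norm `≤ 1` (ultrametric).
[cite: Washington1997, §7.1] -/
theorem norm_tsum_eval_le_one {F : PowerSeries ℚ_[p]} (hF : ∀ k, ‖coeff k F‖ ≤ 1) {a : ℚ_[p]} (ha : ‖a‖ < 1) :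
    ‖∑' k, coeff k F * a ^ k‖ ≤ 1 := by
  refine IsUltrametricDist.norm_tsum_le_of_forall_le_of_nonneg zero_le_one fun k ↦ ?_
  rw [norm_mul, norm_pow]
  exact mul_le_one₀ (hF k) (pow_nonneg (norm_nonneg _) _) (pow_le_one₀ (norm_nonneg _) ha.le)

/-- Evaluation of the power series `1` is `1`. [cite: Washington1997, §7.2] -/
theorem tsum_eval_one (a : ℚ_[p]) : ∑' k, coeff k (1 : PowerSeries ℚ_[p]) * a ^ k = 1 := by
  rw [tsum_eq_single 0]
  · rw [coeff_zero_eq_constantCoeff, map_one, pow_zero, mul_one]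
  · intro k hk
    rw [coeff_one, if_neg hk, zero_mul]

/-- `ev_a((1+T)^s) · ev_a((1+T)^{−s}) = 1` (`binomialSeries_add`: `(1+T)^s(1+T)^{−s} = (1+T)^0 = 1`, and evaluation
is multiplicative). [cite: GreenbergVatsal2000, §1 (p. 9)] -/
theorem tsum_eval_binomialSeries_mul_neg (s : ℤ_[p]) {a : ℚ_[p]} (ha : ‖a‖ < 1) :
    (∑' k, coeff k (binomialSeries ℚ_[p] s) * a ^ k) * ∑' k, coeff k (binomialSeries ℚ_[p] (-s)) * a ^ k = 1 := by
  rw [← tsum_coeff_mul (norm_coeff_binomialSeries_le_one s) (norm_coeff_binomialSeries_le_one (-s)) ha,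
    ← binomialSeries_add, add_neg_cancel, binomialSeries_zero, tsum_eval_one]

/-- **`ev_a((1+T)^s)` is a `p`-adic unit of norm `1`** for every `s ∈ ℤ_p`, `‖a‖ < 1`. At `p = 2`, `a = −2` this is
the value of the Frobenius shift `(1+T)^{−f_m}` of Birch's lemma at the conductor-`8` character.
[cite: GreenbergVatsal2000, §1 (p. 9)] [cite: MazurTateTeitelbaum1986Invent, §I.13] -/
theorem norm_tsum_eval_binomialSeries (s : ℤ_[p]) {a : ℚ_[p]} (ha : ‖a‖ < 1) :
    ‖∑' k, coeff k (binomialSeries ℚ_[p] s) * a ^ k‖ = 1 := by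
  have h1 := norm_tsum_eval_le_one (norm_coeff_binomialSeries_le_one s) ha
  have h2 := norm_tsum_eval_le_one (norm_coeff_binomialSeries_le_one (-s)) ha
  have hprod := congrArg (‖·‖) (tsum_eval_binomialSeries_mul_neg s ha)
  simp only [norm_mul, norm_one] at hprod
  nlinarith [norm_nonneg (∑' k, coeff k (binomialSeries ℚ_[p] s) * a ^ k),
    norm_nonneg (∑' k, coeff k (binomialSeries ℚ_[p] (-s)) * a ^ k)]

/-- The value `ev_a((1+T)^s)` is non-zero. [cite: GreenbergVatsal2000, §1 (p. 9)] -/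
theorem tsum_eval_binomialSeries_ne_zero (s : ℤ_[p]) {a : ℚ_[p]} (ha : ‖a‖ < 1) :
    ∑' k, coeff k (binomialSeries ℚ_[p] s) * a ^ k ≠ 0 := by
  intro h
  have := norm_tsum_eval_binomialSeries s ha
  rw [h, norm_zero] at this
  exact zero_ne_one this

end Literature.NumberTheory.EllipticCurves.PadicEval

end
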